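import Summits.BirchSwinnertonDyer.Rank1Residual.Additive.SignedTwistTowerTwist
import Summits.BirchSwinnertonDyer.Rank1Residual.Additive.SignedTwistPlusSelmerInfty
import HarnessLib

/-!
# The INVARIANT part of Kobayashi's plus Selmer group over `K_∞ = K₀ℚ_∞` IS the plus Selmer group over
# `ℚ_∞`: `Sel⁺(V/K₀ℚ_∞)^{Δ} = Θ_* Θ'_∞ (Sel⁺(V/ℚ_∞))` (cell `bsd-potss`, seat `bsd-potss-ctrl` g2;
# T-e2-R1⁺ piece (i), brick (i-e) — the trivial-character half of the `η`-decomposition of the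
# `ℚ`-internal tower object; TARGET.md v6 §0.12 (e) piece (i))

HONEST FRAMING (cell `bsd-potss`, run/shared/lean/pub/bsd-potss/; FULL-BSD rank ≤ 1 programme,
tranche 1b): TOOL THEOREMS ONLY — no definition, no named Literature fact, no Summits-side fact
`def … : Prop`, no `sorry`, axioms standard; binders x1b's, for BOTH directions of the twist
(`hCV : C • W^{(c)} = V` and `hCW : C' • V^{(c)} = W`); nothing is booked; no label / mark / count
moves; nothing about (C1_η) or `BSD(W, p)` is claimed.

## What
No new dictionary: the `η`-DICTIONARY (D3⁺) for the SWAPPED pair `(V, W = C' • V^{(c)})`,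
`Θ'_∞ (Sel⁺(V/ℚ_∞)) = Sel⁺(W/K₀ℚ_∞)^η` (`map_h1TransportInfty_strictSignedSelmerInfty_one`), composed
with the TOWER TWIST `Θ_* (Sel⁺(W/K₀ℚ_∞)^η) = Sel⁺(V/K₀ℚ_∞)^{η·η} = Sel⁺(V/K₀ℚ_∞)^{1}`
(`map_h1Transport_towerSignedSelmerInftyEta_one`):
* `towerSignedSelmerInftyEta_mul_self` — `Sel^ε(V/K₀ℚ_∞)^{χ·χ} = Sel^ε(V/K₀ℚ_∞)^{1}` (`χ² = 1`);
* **`map_map_strictSignedSelmerInfty_one_eq_invariant`** —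
  `Θ_* (Θ'_∞ (strictSignedSelmerInfty V κ E 1)) = towerSignedSelmerInftyEta V κ K₀ E 1 1`;
* `h1Transport_h1TransportInfty_injective` — the composite `Θ_* ∘ Θ'_∞` is injective;
* `h1Transport_h1TransportInfty_conjH1` — and commutes with `conj_g` for EVERY `g ∈ Γ_ℚ` (the two
  signs `η(g)` cancel): the identification is `Γ`-equivariant, as the dual-data algebra of piece
  (i-g) requires;
* `mem_strictSignedSelmerInfty_one_iff_invariant` — membership form.

References: [Kobayashi2003] Def. 2.1 (p. 5), §4 p. 8 (`X⁺(E/K_∞)^Δ ≅ X⁺(E/ℚ_∞)` by descent);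
[GreenbergLNM1716] §3 (restriction in prime-to-`p` extensions); [Dokchitser2013ParityNotes] §4.
-/

noncomputable section

open scoped Classical

open WeierstrassCurve Field

namespace Summit.BirchSwinnertonDyer.Rank1Residual.Additive.SignedTwist

open Literature.NumberTheory.EllipticCurves Literature.NumberTheory.GaloisRepresentations
  Literature.NumberTheory.EllipticCurves.Kobayashi2003
  Summit.BirchSwinnertonDyer.Rank1Residual.AdditivePotMult ZpExtension

variable (W : WeierstrassCurve ℚ) (K₀ : Type) [Field K₀] [NumberField K₀] {θ : K₀} {c : ℚ}
  (hθ : θ ∉ Set.range (algebraMap ℚ K₀)) (hc : θ ^ 2 = algebraMap ℚ K₀ c)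
  (p : ℕ) [Fact p.Prime] (κ : ZpExtension ℚ p)
  {V : WeierstrassCurve ℚ} {C C' : VariableChange ℚ} (hCV : C • W.quadraticTwist c = V)
  (hCW : C' • V.quadraticTwist c = W)
  (E : Type) [Field E] [Algebra ℚ E]
  (η : absoluteGaloisGroup ℚ →* ℤˣ)
  (hη : ∀ σ : absoluteGaloisGroup ℚ, η σ = 1 ↔ σ • rootInClosure K₀ θ = rootInClosure K₀ θ)
  [(galRange (K := ℚ) K₀).Normal]

/-- `Sel^ε(V/K₀ℚ_∞)^{χ·χ} = Sel^ε(V/K₀ℚ_∞)^{1}`: a `{±1}`-valued character squares to `1`.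
[cite: Kobayashi2003, §4 p. 8] -/
theorem towerSignedSelmerInftyEta_mul_self (χ : absoluteGaloisGroup ℚ →* ℤˣ) (ε : ℤˣ) :
    towerSignedSelmerInftyEta V κ K₀ E (χ * χ) ε = towerSignedSelmerInftyEta V κ K₀ E 1 ε := by
  have h : χ * χ = 1 := by
    ext σ
    rw [MonoidHom.mul_apply, MonoidHom.one_apply, Int.units_mul_self]
  rw [h]

include hη in
/-- **`Θ_* (Θ'_∞ (Sel⁺(V/ℚ_∞))) = Sel⁺(V/K₀ℚ_∞)^{Δ}`** (the invariant = `η = 1` part): (D3⁺) for the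
swapped pair `(V, W)` followed by the tower twist at `χ = η`.
[cite: Kobayashi2003, Def. 2.1 (p. 5), §4 p. 8] [cite: GreenbergLNM1716, §3] -/
theorem map_map_strictSignedSelmerInfty_one_eq_invariant
    (hD : ∀ g : absoluteGaloisGroup ℚ, ∃ τ : absoluteGaloisGroup E,
      (resGalOfEmb (closureEmb (K := ℚ) E) τ)⁻¹ * g ∈ towerTopSubgroup κ K₀)
    (hκ₀ : ∀ x, ∃ g ∈ galRange (K := ℚ) K₀, κ g = x)
    (hcop : (galRange (K := ℚ) K₀).index.Coprime p) :
    ((strictSignedSelmerInfty V κ E 1).map (h1TransportInfty V K₀ hθ hc p κ hCW)).map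
        (h1Transport W K₀ hθ hc p hCV (towerTopSubgroup κ K₀) inf_le_right :
          W.subgroupH1 p (towerTopSubgroup κ K₀) →+ V.subgroupH1 p (towerTopSubgroup κ K₀)) =
      towerSignedSelmerInftyEta V κ K₀ E 1 1 := by
  rw [map_h1TransportInfty_strictSignedSelmerInfty_one V K₀ hθ hc p κ hCW E η hη hD hκ₀ hcop,
    map_h1Transport_towerSignedSelmerInftyEta_one W K₀ hθ hc p κ hCV E η hη η,
    towerSignedSelmerInftyEta_mul_self]

/-- **The composite `Θ_* ∘ Θ'_∞` is injective** (`Θ'_∞` by `h1TransportInfty_injective`, `Θ_*` an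
isomorphism). [cite: GreenbergLNM1716, §5 p. 143] -/
theorem h1Transport_h1TransportInfty_injective (hcop : (galRange (K := ℚ) K₀).index.Coprime p) :
    Function.Injective fun s : V.subgroupH1 p κ.kerSubgroup ↦
      h1Transport W K₀ hθ hc p hCV (towerTopSubgroup κ K₀) inf_le_right
        (h1TransportInfty V K₀ hθ hc p κ hCW s) :=
  (AddEquiv.injective _).comp (h1TransportInfty_injective V K₀ hθ hc p κ hCW hcop)

include hη in
/-- **`Θ_* ∘ Θ'_∞` commutes with `conj_g` for every `g ∈ Γ_ℚ`**: each factor picks up the sign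
`η(g)` (`h1TransportInfty_conjH1`, `h1Transport_conjH1`) and `η(g)² = 1`.
[cite: Dokchitser2013ParityNotes, §4] [cite: Kobayashi2003, §4 p. 8] -/
theorem h1Transport_h1TransportInfty_conjH1 (g : absoluteGaloisGroup ℚ)
    (s : V.subgroupH1 p κ.kerSubgroup) :
    h1Transport W K₀ hθ hc p hCV (towerTopSubgroup κ K₀) inf_le_right
        (h1TransportInfty V K₀ hθ hc p κ hCW (V.conjH1 p κ.kerSubgroup g s)) =
      V.conjH1 p (towerTopSubgroup κ K₀) g
        (h1Transport W K₀ hθ hc p hCV (towerTopSubgroup κ K₀) inf_le_right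
          (h1TransportInfty V K₀ hθ hc p κ hCW s)) := by
  rw [h1TransportInfty_conjH1 V K₀ hθ hc p κ hCW η hη, map_zsmul,
    h1Transport_conjH1 W K₀ hθ hc p hCV η hη, units_smul_units_smul]

include hη in
/-- **Membership form**: `s ∈ Sel⁺(V/ℚ_∞) ↔ Θ_* (Θ'_∞ s) ∈ Sel⁺(V/K₀ℚ_∞)^{Δ}`.
[cite: Kobayashi2003, Def. 2.1 (p. 5), §4 p. 8] -/
theorem mem_strictSignedSelmerInfty_one_iff_invariant
    (hD : ∀ g : absoluteGaloisGroup ℚ, ∃ τ : absoluteGaloisGroup E,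
      (resGalOfEmb (closureEmb (K := ℚ) E) τ)⁻¹ * g ∈ towerTopSubgroup κ K₀)
    (hκ₀ : ∀ x, ∃ g ∈ galRange (K := ℚ) K₀, κ g = x)
    (hcop : (galRange (K := ℚ) K₀).index.Coprime p) (s : V.subgroupH1 p κ.kerSubgroup) :
    s ∈ strictSignedSelmerInfty V κ E 1 ↔
      h1Transport W K₀ hθ hc p hCV (towerTopSubgroup κ K₀) inf_le_right
          (h1TransportInfty V K₀ hθ hc p κ hCW s) ∈ towerSignedSelmerInftyEta V κ K₀ E 1 1 := by
  rw [← map_map_strictSignedSelmerInfty_one_eq_invariant W K₀ hθ hc p κ hCV hCW E η hη hD hκ₀ hcop]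
  constructor
  · exact fun hs ↦ ⟨_, ⟨s, hs, rfl⟩, rfl⟩
  · rintro ⟨t, ⟨s', hs', rfl⟩, he⟩
    rwa [← h1Transport_h1TransportInfty_injective W K₀ hθ hc p κ hCV hCW hcop he]

end Summit.BirchSwinnertonDyer.Rank1Residual.Additive.SignedTwist

end
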